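import Summits.BirchSwinnertonDyer.BirchSwinnertonDyer.Theorems.ResidualThetaTransportAtTwoSignedMuSeedAtTwoPlusTiltRecursion
import HarnessLib

/-!
# `D log` of the `ρ`-product `θ̄(λt)·θ̄(λ²t)` is the `ρ`-symmetrisation `λΦ(λt) + λ²Φ(λ²t)` of `Φ = D log θ̄`
# — the bridge between the tilt card's `θ̄^ρ = θ̄∘[ζ₃]·θ̄∘[ζ₃²]` (S1 (iii)) and the jet card's `S₀ = Φ_ρ = λΦ_χ∘[ζ₃] + λ²Φ_χ∘[ζ₃²]` (J3)
# (seed crux `SignedMuSeedAtTwoPlus` stmt-BirchSwinnertonDyer-21438; Kμ⁺ stmt-BirchSwinnertonDyer-20689; route `ResidualThetaTransportAtTwo`)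

Cell `bsd-wall`, width seat `bsd-wall-rtt-p4-w2` g13 (`--supports`, closes nothing).  THEOREMS ONLY (no `def`, no named fact, no instance,
no `sorry`); the lines are NOT registered (W-79); nothing about any curve, unit or `μ`-invariant is asserted; BSD is not proved by this.

With rotations DIAGONAL on the parameter (`[ζ₃]t = ζ₃·t`, the tree's `Tilt.hom_tiltCurve_eq_C_mul_X` for the tilt curve) a rotation is
`PowerSeries.rescale`, and it is NOT an invariant substitution (`dt ↦ ζ₃ dt`), so `D log (Z∘[ζ]) = ζ·(D log Z)∘[ζ]`:

* `derivative_rescale'` — `(f(ct))' = c·f'(ct)` (a local copy of the tree's `derivative_rescale`, to keep imports small);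
* `logDeriv_rescale` — `Z·S = u·Z'`, `u(ct) = u(t)` ⟹ `Z(ct)·(c·S(ct)) = u·(Z(ct))'`;
* **`logDeriv_rhoProduct`** — `Z·S = u·Z'`, `u(λt) = u(t)` ⟹ for `Z^ρ := Z(λt)·Z(λ²t)` and `S^ρ := λS(λt) + λ²S(λ²t)` (EXACTLY the series
  `C l * rescale l Φ + C (l^2) * rescale (l^2) Φ` of `…JetRhoSymmetrisation.rhoSymm_levelZero_dichotomy`): `Z^ρ · S^ρ = u · (Z^ρ)'`;
  `logDeriv_rhoProduct_one` — the tilt-curve case `u = η̄ = 1` (`Tilt.formalEta_map_tiltCurve_eq_one`).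

So the chain «orbit factor `θ̄^ρ` (product of rotations) ⟶ `Φ_ρ = λΦ∘[ζ₃] + λ²Φ∘[ζ₃²]` ⟶ level-zero dichotomy» is kernel algebra end to end;
what remains of J3 is the dictionary S1 (ii) (`θ̄` = reduced Robert function) itself. [folklore]
-/

set_option autoImplicit false
-- the Theorems namespace of this sub repeats the summit name by design (D-0017 nested layout)
set_option linter.dupNamespace false

noncomputable section

open PowerSeries

namespace Summit.BirchSwinnertonDyer.BirchSwinnertonDyer.Theorems.SignedMuAtTwo.JetCharacterSums

variable {k : Type*} [CommRing k]

/-- `(f(ct))' = c·f'(ct)` (chain rule for a rescaling; local copy of the tree's `derivative_rescale`). [folklore] -/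
theorem derivative_rescale' (c : k) (f : k⟦X⟧) : d⁄dX k (rescale c f) = C c * rescale c (d⁄dX k f) := by
  ext n
  rw [coeff_derivative, coeff_rescale, coeff_C_mul, coeff_rescale, coeff_derivative, pow_succ]
  ring

/-- **`D log (Z∘[c]) = c·(D log Z)∘[c]`** for a diagonal rotation `t ↦ ct` preserving `u`: `Z·S = u·Z'` and `u(ct) = u(t)` give
`Z(ct)·(c·S(ct)) = u·(Z(ct))'`. [folklore] -/
theorem logDeriv_rescale {u Z S : k⟦X⟧} (c : k) (hu : rescale c u = u) (hS : Z * S = u * d⁄dX k Z) :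
    rescale c Z * (C c * rescale c S) = u * d⁄dX k (rescale c Z) := by
  have h := congrArg (rescale c) hS
  rw [map_mul, map_mul, hu] at h
  rw [derivative_rescale']
  linear_combination C c * h

/-- `u(c²t) = u(t)` from `u(ct) = u(t)`. [folklore] -/
theorem rescale_sq_eq_self {u : k⟦X⟧} {c : k} (hu : rescale c u = u) : rescale (c ^ 2) u = u := by
  rw [sq, rescale_mul, RingHom.comp_apply, hu, hu]

/-- **`D log` of the `ρ`-product is the `ρ`-symmetrisation.**  If `Z·S = u·Z'` (`S = D log Z` for `D = u·d/dt`) and `u(λt) = u(t)`, then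
for `Z^ρ := Z(λt)·Z(λ²t)` and `S^ρ := λ·S(λt) + λ²·S(λ²t)`: `Z^ρ · S^ρ = u · (Z^ρ)'`.  With `[ζ₃]t = ζ₃t` (`Tilt.hom_tiltCurve_eq_C_mul_X`) this
reads `D log(θ̄∘[ζ₃]·θ̄∘[ζ₃²]) = λΦ∘[ζ₃] + λ²Φ∘[ζ₃²]` for `Φ = D log θ̄` — the series `S₀ = Φ_ρ` of the jet card, in the exact shape
`C l * rescale l Φ + C (l ^ 2) * rescale (l ^ 2) Φ` consumed by `rhoSymm_levelZero_dichotomy`. [folklore] -/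
theorem logDeriv_rhoProduct {u Z S : k⟦X⟧} {l : k} (hu : rescale l u = u) (hS : Z * S = u * d⁄dX k Z) :
    (rescale l Z * rescale (l ^ 2) Z) * (C l * rescale l S + C (l ^ 2) * rescale (l ^ 2) S) =
      u * d⁄dX k (rescale l Z * rescale (l ^ 2) Z) :=
  Tilt.logDeriv_mul (logDeriv_rescale l hu hS) (logDeriv_rescale (l ^ 2) (rescale_sq_eq_self hu) hS)

/-- The tilt-curve case `u = η̄ = 1` (`Tilt.formalEta_map_tiltCurve_eq_one`): `Z·S = Z'` ⟹ `Z^ρ·S^ρ = (Z^ρ)'`. [folklore] -/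
theorem logDeriv_rhoProduct_one {Z S : k⟦X⟧} {l : k} (hS : Z * S = d⁄dX k Z) :
    (rescale l Z * rescale (l ^ 2) Z) * (C l * rescale l S + C (l ^ 2) * rescale (l ^ 2) S) =
      d⁄dX k (rescale l Z * rescale (l ^ 2) Z) := by
  have h := logDeriv_rhoProduct (u := 1) (Z := Z) (S := S) (l := l) (by rw [map_one]) (by rw [one_mul]; exact hS)
  rwa [one_mul] at h

end Summit.BirchSwinnertonDyer.BirchSwinnertonDyer.Theorems.SignedMuAtTwo.JetCharacterSums

end
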